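import Mathlib
import Literature.Barriers.MatrixMultiplication.NormalizerBarrier
import Summits.MatrixMultiplication.MatrixMultiplication.Theorems.SubgroupIdentityDesigns.Negative.GradedNormalizerCount
import Summits.MatrixMultiplication.MatrixMultiplication.Theorems.GradedDesignFamily.Negative.PackingLaw
import Summits.MatrixMultiplication.MatrixMultiplication.Theorems.LevelOneGL2Designs.Negative.LevelSpace
import Summits.MatrixMultiplication.MatrixMultiplication.Theorems.LieRankDesigns.Negative.Basics

/-!
# The graded packing law applies to `SubgroupIdentityDesigns`
(negative-side helper for the crux `SubgroupIdentityDesigns`, stmt-MatrixMultiplication-14079;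
cell B2b-5 `b2b-lgcu-borel`, gen 10)

A BRIDGE, not new mathematics.  The sibling crux `GradedDesignFamily` (stmt-7610) has a landed
negative-side theory (`GradedDesignFamily/Negative/ExponentTwoEndpoint`, `PackingLaw`): for a
finite group `G`, a bi-invariant `J ≤ ℂ^G` and a `J`-SEPARATED triple of finsets `X, Y, Z`
(for all `x₀ ∈ X`, `z₀ ∈ Z` some `f ∈ J` reads `δ_{(x₀,·,z₀)}` on `X⁻¹ Y Y⁻¹ Z`), every witness of
`Σᶠ_{Irr ∩ J} χ(1)^(2+ε) < V^((2+ε)/3)` obeys the walls `2V² ≤ (dim J)³`, the PACKING LAW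
`#(Irr ∩ J)^ε > 2^((2+ε)/3)`, `k(G)^ε, |G|^ε > 2^((2+ε)/3)`, and NO FIXED HOST.  The present crux
quantifies instead over SUBGROUP triples `H₁, H₂, H₃ ≤ GL_m(𝔽_p)` with the subgroup TPP and ONE
identity test `f ∈ F_k` (`f 1 = 1`, `f (abc) = 0` for `abc ≠ 1`).  Proved here (sorry-free):

* `separated` — subgroup TPP + one identity test in a bi-invariant `J` ⇒ the triple
  `(H₁, H₂, H₃)` is `J`-separated (the tests are the bi-translates `g ↦ f (x₀ g z₀⁻¹)`, read
  through `idTest_apply_eq_ite`); `exists_separated` packages it with `V = |H₁||H₂||H₃|`;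
* abstract consequences for subgroup-TPP identity designs in any finite group:
  `two_lt_ncard_rpow` (`2^((2+ε)/3) < #(Irr ∩ J)^ε`), `two_le_ncard`, `two_le_finrank`,
  `two_mul_volume_sq_le_finrank_cube` (`2V² ≤ (dim J)³`), `conjClasses_law`, `card_law`,
  `no_witness_of_small_eps` (`ε · log k(G) ≤ (2/3) log 2` ⇒ no witness);
* the crux's literal terms (`G = GL_m(𝔽_p)`, `J = F_k|_G = levelSubmodule p m k`, the design
  clause verbatim, `budget p m k (2+ε) < V^((2+ε)/3)`): `crux_law`
  (`2^((2+ε)/3) < #(Irr(GL_m(𝔽_p)) ∩ F_k)^ε`), `crux_conjClasses_law`, `crux_card_law`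
  (`|GL_m(𝔽_p)|^ε > 2^((2+ε)/3)`), `crux_walls` (`2V² ≤ (dim F_k|_G)³`), and
  `crux_no_fixed_host`: a fixed `GL_m(𝔽_p)` carries NO witness of the crux at any
  `ε ≤ (2/3) log 2 / log k(GL_m(𝔽_p))` — every witness family must let `p^m → ∞` as `ε → 0`.

VALUE = a formal bridge making the sibling crux's landed packing law available for this crux's
witnesses (theorem about hypothetical witnesses), NOT summit progress; the crux item stays open.
-/

set_option linter.dupNamespace false

noncomputable section

open scoped BigOperators Classical
open Module Literature.RepresentationTheory.FiniteGroups
open Literature.Barriers.MatrixMultiplication (SubgroupTPP)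

namespace Summit.MatrixMultiplication.MatrixMultiplication.Theorems.SubgroupIdentityDesigns.Negative
namespace PackingBridge

open Summit.MatrixMultiplication.MatrixMultiplication.Theorems.LieRankDesigns.Negative
  (GLm Mat levelSet budget fourierFn RankSupp)
open Summit.MatrixMultiplication.MatrixMultiplication.Theorems.LevelOneGL2Designs.Negative
  (levelSubmodule mem_levelSubmodule_iff levelSubmodule_bi_inv)

section Abstract

variable {G : Type} [Group G]

/-- **Subgroup TPP + one identity test ⇒ `J`-separated.**  For finsets `X ⊆ H₁`, `Y ⊆ H₂`,
`Z ⊆ H₃`, the bi-translate `g ↦ f (x₀ g z₀⁻¹)` of the identity test reads `δ_{(x₀, y', z₀)}`: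
`x₀ x⁻¹ · y y'⁻¹ · z z₀⁻¹ ∈ H₁H₂H₃` is `1` iff all three factors are (TPP). [folklore] -/
theorem separated (J : Submodule ℂ (G → ℂ))
    (hJ : ∀ f ∈ J, ∀ a b : G, (fun g : G => f (a * g * b)) ∈ J)
    {H₁ H₂ H₃ : Subgroup G} (htpp : SubgroupTPP H₁ H₂ H₃)
    {f : G → ℂ} (hf : f ∈ J) (h1 : f 1 = 1)
    (h0 : ∀ a ∈ H₁, ∀ b ∈ H₂, ∀ c ∈ H₃, a * b * c ≠ 1 → f (a * b * c) = 0)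
    (X Y Z : Finset G) (hX : ∀ x ∈ X, x ∈ H₁) (hY : ∀ y ∈ Y, y ∈ H₂) (hZ : ∀ z ∈ Z, z ∈ H₃) :
    ∀ x₀ ∈ X, ∀ z₀ ∈ Z, ∃ f ∈ J, ∀ x ∈ X, ∀ y ∈ Y, ∀ y' ∈ Y, ∀ z ∈ Z,
      (x = x₀ ∧ y = y' ∧ z = z₀ → f (x⁻¹ * y * y'⁻¹ * z) = 1) ∧
      (¬ (x = x₀ ∧ y = y' ∧ z = z₀) → f (x⁻¹ * y * y'⁻¹ * z) = 0) := by
  intro x₀ hx₀ z₀ hz₀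
  refine ⟨fun g => f (x₀ * g * z₀⁻¹), hJ f hf x₀ z₀⁻¹, ?_⟩
  intro x hx y hy y' hy' z hz
  have ha : x₀ * x⁻¹ ∈ H₁ := H₁.mul_mem (hX _ hx₀) (H₁.inv_mem (hX _ hx))
  have hb : y * y'⁻¹ ∈ H₂ := H₂.mul_mem (hY _ hy) (H₂.inv_mem (hY _ hy'))
  have hc : z * z₀⁻¹ ∈ H₃ := H₃.mul_mem (hZ _ hz) (H₃.inv_mem (hZ _ hz₀))
  have key : f (x₀ * (x⁻¹ * y * y'⁻¹ * z) * z₀⁻¹) =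
      if x₀ * x⁻¹ = 1 ∧ y * y'⁻¹ = 1 ∧ z * z₀⁻¹ = 1 then 1 else 0 := by
    rw [show x₀ * (x⁻¹ * y * y'⁻¹ * z) * z₀⁻¹ = (x₀ * x⁻¹) * (y * y'⁻¹) * (z * z₀⁻¹) by group]
    exact idTest_apply_eq_ite htpp h1 h0 ha hb hc
  have hiff : (x₀ * x⁻¹ = 1 ∧ y * y'⁻¹ = 1 ∧ z * z₀⁻¹ = 1) ↔ (x = x₀ ∧ y = y' ∧ z = z₀) :=
    (mul_inv_eq_one.trans eq_comm).and (mul_inv_eq_one.and mul_inv_eq_one)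
  refine ⟨fun h => ?_, fun h => ?_⟩
  · show f (x₀ * (x⁻¹ * y * y'⁻¹ * z) * z₀⁻¹) = 1
    rw [key, if_pos (hiff.2 h)]
  · show f (x₀ * (x⁻¹ * y * y'⁻¹ * z) * z₀⁻¹) = 0
    rw [key, if_neg (fun h' => h (hiff.1 h'))]

variable [Fintype G]

/-- `|H|` is the size of the finset of `H`. -/
theorem card_toFinset (H : Subgroup G) : ((H : Set G).toFinset).card = Nat.card H :=
  (Nat.card_eq_card_toFinset (H : Set G)).symm

/-- **Packaging**: a subgroup-TPP triple with one identity test in a bi-invariant `J` yields a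
`J`-separated triple of finsets of volume `|H₁||H₂||H₃|` (the hypothesis shape of
`GradedDesignFamily.Negative.PackingLaw`). -/
theorem exists_separated (J : Submodule ℂ (G → ℂ))
    (hJ : ∀ f ∈ J, ∀ a b : G, (fun g : G => f (a * g * b)) ∈ J)
    {H₁ H₂ H₃ : Subgroup G} (htpp : SubgroupTPP H₁ H₂ H₃)
    {f : G → ℂ} (hf : f ∈ J) (h1 : f 1 = 1)
    (h0 : ∀ a ∈ H₁, ∀ b ∈ H₂, ∀ c ∈ H₃, a * b * c ≠ 1 → f (a * b * c) = 0) :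
    ∃ X Y Z : Finset G, X.card * Y.card * Z.card = Nat.card H₁ * Nat.card H₂ * Nat.card H₃ ∧
      ∀ x₀ ∈ X, ∀ z₀ ∈ Z, ∃ f ∈ J, ∀ x ∈ X, ∀ y ∈ Y, ∀ y' ∈ Y, ∀ z ∈ Z,
        (x = x₀ ∧ y = y' ∧ z = z₀ → f (x⁻¹ * y * y'⁻¹ * z) = 1) ∧
        (¬ (x = x₀ ∧ y = y' ∧ z = z₀) → f (x⁻¹ * y * y'⁻¹ * z) = 0) :=
  ⟨(H₁ : Set G).toFinset, (H₂ : Set G).toFinset, (H₃ : Set G).toFinset,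
    by rw [card_toFinset, card_toFinset, card_toFinset],
    separated J hJ htpp hf h1 h0 _ _ _ (fun x hx => by simpa using hx)
      (fun y hy => by simpa using hy) (fun z hz => by simpa using hz)⟩

/-- **Packing law for subgroup-TPP identity designs**: `2^((2+ε)/3) < #(Irr(G) ∩ J)^ε`. -/
theorem two_lt_ncard_rpow (J : Submodule ℂ (G → ℂ))
    (hJ : ∀ f ∈ J, ∀ a b : G, (fun g : G => f (a * g * b)) ∈ J)
    {H₁ H₂ H₃ : Subgroup G} (htpp : SubgroupTPP H₁ H₂ H₃)
    {f : G → ℂ} (hf : f ∈ J) (h1 : f 1 = 1)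
    (h0 : ∀ a ∈ H₁, ∀ b ∈ H₂, ∀ c ∈ H₃, a * b * c ≠ 1 → f (a * b * c) = 0)
    {ε : ℝ} (hε : 0 < ε)
    (hlt : (∑ᶠ χ ∈ irrChars G ∩ (J : Set (G → ℂ)), (χ 1).re ^ ((2 + ε) : ℝ)) <
      ((Nat.card H₁ * Nat.card H₂ * Nat.card H₃ : ℕ) : ℝ) ^ ((2 + ε) / 3)) :
    (2 : ℝ) ^ ((2 + ε) / 3) < ((irrChars G ∩ (J : Set (G → ℂ))).ncard : ℝ) ^ ε := by
  obtain ⟨X, Y, Z, hV, hsep⟩ := exists_separated J hJ htpp hf h1 h0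
  exact GradedDesignFamily.Negative.ncard_irrChars_inter_law hε J hJ X Y Z hsep (by rwa [hV])

/-- Every subgroup-TPP identity design beating the exponent `2 + ε` sees `≥ 2` irreducibles. -/
theorem two_le_ncard (J : Submodule ℂ (G → ℂ))
    (hJ : ∀ f ∈ J, ∀ a b : G, (fun g : G => f (a * g * b)) ∈ J)
    {H₁ H₂ H₃ : Subgroup G} (htpp : SubgroupTPP H₁ H₂ H₃)
    {f : G → ℂ} (hf : f ∈ J) (h1 : f 1 = 1)
    (h0 : ∀ a ∈ H₁, ∀ b ∈ H₂, ∀ c ∈ H₃, a * b * c ≠ 1 → f (a * b * c) = 0)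
    {ε : ℝ} (hε : 0 < ε)
    (hlt : (∑ᶠ χ ∈ irrChars G ∩ (J : Set (G → ℂ)), (χ 1).re ^ ((2 + ε) : ℝ)) <
      ((Nat.card H₁ * Nat.card H₂ * Nat.card H₃ : ℕ) : ℝ) ^ ((2 + ε) / 3)) :
    2 ≤ (irrChars G ∩ (J : Set (G → ℂ))).ncard := by
  obtain ⟨X, Y, Z, hV, hsep⟩ := exists_separated J hJ htpp hf h1 h0
  exact GradedDesignFamily.Negative.two_le_ncard_irrChars_inter hε J hJ X Y Z hsep (by rwa [hV])

/-- A subgroup-TPP identity design beating `2 + ε` has `dim J ≥ 2`. -/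
theorem two_le_finrank (J : Submodule ℂ (G → ℂ))
    (hJ : ∀ f ∈ J, ∀ a b : G, (fun g : G => f (a * g * b)) ∈ J)
    {H₁ H₂ H₃ : Subgroup G} (htpp : SubgroupTPP H₁ H₂ H₃)
    {f : G → ℂ} (hf : f ∈ J) (h1 : f 1 = 1)
    (h0 : ∀ a ∈ H₁, ∀ b ∈ H₂, ∀ c ∈ H₃, a * b * c ≠ 1 → f (a * b * c) = 0)
    {ε : ℝ} (hε : 0 < ε)
    (hlt : (∑ᶠ χ ∈ irrChars G ∩ (J : Set (G → ℂ)), (χ 1).re ^ ((2 + ε) : ℝ)) <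
      ((Nat.card H₁ * Nat.card H₂ * Nat.card H₃ : ℕ) : ℝ) ^ ((2 + ε) / 3)) :
    2 ≤ finrank ℂ J := by
  obtain ⟨X, Y, Z, hV, hsep⟩ := exists_separated J hJ htpp hf h1 h0
  exact GradedDesignFamily.Negative.two_le_finrank_of_witness hε J hJ X Y Z hsep (by rwa [hV])

/-- **Sharper walls** `2 V² ≤ (dim J)³` for subgroup-TPP identity designs beating `2 + ε`. -/
theorem two_mul_volume_sq_le_finrank_cube (J : Submodule ℂ (G → ℂ))
    (hJ : ∀ f ∈ J, ∀ a b : G, (fun g : G => f (a * g * b)) ∈ J)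
    {H₁ H₂ H₃ : Subgroup G} (htpp : SubgroupTPP H₁ H₂ H₃)
    {f : G → ℂ} (hf : f ∈ J) (h1 : f 1 = 1)
    (h0 : ∀ a ∈ H₁, ∀ b ∈ H₂, ∀ c ∈ H₃, a * b * c ≠ 1 → f (a * b * c) = 0)
    {ε : ℝ} (hε : 0 < ε)
    (hlt : (∑ᶠ χ ∈ irrChars G ∩ (J : Set (G → ℂ)), (χ 1).re ^ ((2 + ε) : ℝ)) <
      ((Nat.card H₁ * Nat.card H₂ * Nat.card H₃ : ℕ) : ℝ) ^ ((2 + ε) / 3)) :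
    2 * (Nat.card H₁ * Nat.card H₂ * Nat.card H₃) ^ 2 ≤ (finrank ℂ J) ^ 3 := by
  obtain ⟨X, Y, Z, hV, hsep⟩ := exists_separated J hJ htpp hf h1 h0
  have h := GradedDesignFamily.Negative.two_mul_volume_sq_le_finrank_cube J hJ X Y Z hsep
    (GradedDesignFamily.Negative.two_le_finrank_of_witness hε J hJ X Y Z hsep (by rwa [hV]))
  rwa [hV] at h

/-- **Host form** `2^((2+ε)/3) < k(G)^ε` for subgroup-TPP identity designs. -/
theorem conjClasses_law (J : Submodule ℂ (G → ℂ))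
    (hJ : ∀ f ∈ J, ∀ a b : G, (fun g : G => f (a * g * b)) ∈ J)
    {H₁ H₂ H₃ : Subgroup G} (htpp : SubgroupTPP H₁ H₂ H₃)
    {f : G → ℂ} (hf : f ∈ J) (h1 : f 1 = 1)
    (h0 : ∀ a ∈ H₁, ∀ b ∈ H₂, ∀ c ∈ H₃, a * b * c ≠ 1 → f (a * b * c) = 0)
    {ε : ℝ} (hε : 0 < ε)
    (hlt : (∑ᶠ χ ∈ irrChars G ∩ (J : Set (G → ℂ)), (χ 1).re ^ ((2 + ε) : ℝ)) <
      ((Nat.card H₁ * Nat.card H₂ * Nat.card H₃ : ℕ) : ℝ) ^ ((2 + ε) / 3)) :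
    (2 : ℝ) ^ ((2 + ε) / 3) < (Nat.card (ConjClasses G) : ℝ) ^ ε := by
  obtain ⟨X, Y, Z, hV, hsep⟩ := exists_separated J hJ htpp hf h1 h0
  exact GradedDesignFamily.Negative.conjClasses_law hε J hJ X Y Z hsep (by rwa [hV])

/-- **Order form** `2^((2+ε)/3) < |G|^ε` for subgroup-TPP identity designs. -/
theorem card_law (J : Submodule ℂ (G → ℂ))
    (hJ : ∀ f ∈ J, ∀ a b : G, (fun g : G => f (a * g * b)) ∈ J)
    {H₁ H₂ H₃ : Subgroup G} (htpp : SubgroupTPP H₁ H₂ H₃)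
    {f : G → ℂ} (hf : f ∈ J) (h1 : f 1 = 1)
    (h0 : ∀ a ∈ H₁, ∀ b ∈ H₂, ∀ c ∈ H₃, a * b * c ≠ 1 → f (a * b * c) = 0)
    {ε : ℝ} (hε : 0 < ε)
    (hlt : (∑ᶠ χ ∈ irrChars G ∩ (J : Set (G → ℂ)), (χ 1).re ^ ((2 + ε) : ℝ)) <
      ((Nat.card H₁ * Nat.card H₂ * Nat.card H₃ : ℕ) : ℝ) ^ ((2 + ε) / 3)) :
    (2 : ℝ) ^ ((2 + ε) / 3) < (Nat.card G : ℝ) ^ ε := by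
  obtain ⟨X, Y, Z, hV, hsep⟩ := exists_separated J hJ htpp hf h1 h0
  exact GradedDesignFamily.Negative.card_law hε J hJ X Y Z hsep (by rwa [hV])

/-- **No fixed host, quantitative**: a finite group carries no subgroup-TPP identity design
beating `2 + ε` once `ε · log k(G) ≤ (2/3) log 2`. -/
theorem no_witness_of_small_eps (J : Submodule ℂ (G → ℂ))
    (hJ : ∀ f ∈ J, ∀ a b : G, (fun g : G => f (a * g * b)) ∈ J)
    {H₁ H₂ H₃ : Subgroup G} (htpp : SubgroupTPP H₁ H₂ H₃)
    {f : G → ℂ} (hf : f ∈ J) (h1 : f 1 = 1)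
    (h0 : ∀ a ∈ H₁, ∀ b ∈ H₂, ∀ c ∈ H₃, a * b * c ≠ 1 → f (a * b * c) = 0)
    {ε : ℝ} (hε : 0 < ε) (hsmall : ε * Real.log (Nat.card (ConjClasses G)) ≤ 2 / 3 * Real.log 2) :
    ¬ (∑ᶠ χ ∈ irrChars G ∩ (J : Set (G → ℂ)), (χ 1).re ^ ((2 + ε) : ℝ)) <
      ((Nat.card H₁ * Nat.card H₂ * Nat.card H₃ : ℕ) : ℝ) ^ ((2 + ε) / 3) := by
  obtain ⟨X, Y, Z, hV, hsep⟩ := exists_separated J hJ htpp hf h1 h0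
  have h := GradedDesignFamily.Negative.no_witness_of_small_eps hε hsmall J hJ X Y Z hsep
  rwa [hV] at h

end Abstract

/-! ## The crux's literal terms: `G = GL_m(𝔽_p)`, `J = F_k|_G` -/

section Crux

variable {p m k : ℕ} [hp : Fact p.Prime]

/-- As sets, `levelSubmodule p m k = levelSet p m k`. -/
theorem coe_levelSubmodule : (levelSubmodule p m k : Set (GLm p m → ℂ)) = levelSet p m k :=
  Set.ext fun _ => mem_levelSubmodule_iff

/-- The crux's budget is the graded budget of `J = F_k|_G`. -/
theorem budget_eq (s : ℝ) :
    budget p m k s =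
      ∑ᶠ χ ∈ irrChars (GLm p m) ∩ (levelSubmodule p m k : Set (GLm p m → ℂ)), (χ 1).re ^ s := by
  rw [coe_levelSubmodule]; rfl

/-- The crux's design clause yields an identity test in `J = levelSubmodule p m k`. -/
theorem exists_test {H₁ H₂ H₃ : Subgroup (GLm p m)}
    (hdes : ∃ c : Mat p m → ℂ, (∀ M, k < M.rank → c M = 0) ∧
      (∑ M, c M * ZMod.stdAddChar (Matrix.trace (M * ((1 : GLm p m) : Mat p m)))) = 1 ∧
      ∀ a ∈ H₁, ∀ b ∈ H₂, ∀ g ∈ H₃, a * b * g ≠ 1 →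
        (∑ M, c M * ZMod.stdAddChar (Matrix.trace (M * ((a * b * g : GLm p m) : Mat p m)))) = 0) :
    ∃ f ∈ levelSubmodule p m k, f 1 = 1 ∧
      ∀ a ∈ H₁, ∀ b ∈ H₂, ∀ g ∈ H₃, a * b * g ≠ 1 → f (a * b * g) = 0 := by
  obtain ⟨c, hc, h1, h0⟩ := hdes
  exact ⟨fourierFn c, mem_levelSubmodule_iff.2 ⟨c, hc, fun _ => rfl⟩, h1, h0⟩

/-- **PACKING LAW FOR THE CRUX.**  Any witness of `SubgroupIdentityDesigns` at `ε` (subgroup TPP,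
the design clause verbatim, `budget p m k (2+ε) < V^((2+ε)/3)`) has
`2^((2+ε)/3) < #(Irr(GL_m(𝔽_p)) ∩ F_k)^ε`. -/
theorem crux_law {ε : ℝ} (hε : 0 < ε) {H₁ H₂ H₃ : Subgroup (GLm p m)}
    (htpp : SubgroupTPP H₁ H₂ H₃)
    (hdes : ∃ c : Mat p m → ℂ, (∀ M, k < M.rank → c M = 0) ∧
      (∑ M, c M * ZMod.stdAddChar (Matrix.trace (M * ((1 : GLm p m) : Mat p m)))) = 1 ∧
      ∀ a ∈ H₁, ∀ b ∈ H₂, ∀ g ∈ H₃, a * b * g ≠ 1 →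
        (∑ M, c M * ZMod.stdAddChar (Matrix.trace (M * ((a * b * g : GLm p m) : Mat p m)))) = 0)
    (hlt : budget p m k (2 + ε) <
      ((Nat.card H₁ * Nat.card H₂ * Nat.card H₃ : ℕ) : ℝ) ^ ((2 + ε) / 3)) :
    (2 : ℝ) ^ ((2 + ε) / 3) < ((irrChars (GLm p m) ∩ levelSet p m k).ncard : ℝ) ^ ε := by
  obtain ⟨f, hf, h1, h0⟩ := exists_test hdes
  have h := two_lt_ncard_rpow (levelSubmodule p m k) levelSubmodule_bi_inv htpp hf h1 h0 hε
    (by rwa [← budget_eq])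
  rwa [coe_levelSubmodule] at h

/-- **Host form for the crux**: `2^((2+ε)/3) < k(GL_m(𝔽_p))^ε`. -/
theorem crux_conjClasses_law {ε : ℝ} (hε : 0 < ε) {H₁ H₂ H₃ : Subgroup (GLm p m)}
    (htpp : SubgroupTPP H₁ H₂ H₃)
    (hdes : ∃ c : Mat p m → ℂ, (∀ M, k < M.rank → c M = 0) ∧
      (∑ M, c M * ZMod.stdAddChar (Matrix.trace (M * ((1 : GLm p m) : Mat p m)))) = 1 ∧
      ∀ a ∈ H₁, ∀ b ∈ H₂, ∀ g ∈ H₃, a * b * g ≠ 1 →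
        (∑ M, c M * ZMod.stdAddChar (Matrix.trace (M * ((a * b * g : GLm p m) : Mat p m)))) = 0)
    (hlt : budget p m k (2 + ε) <
      ((Nat.card H₁ * Nat.card H₂ * Nat.card H₃ : ℕ) : ℝ) ^ ((2 + ε) / 3)) :
    (2 : ℝ) ^ ((2 + ε) / 3) < (Nat.card (ConjClasses (GLm p m)) : ℝ) ^ ε := by
  obtain ⟨f, hf, h1, h0⟩ := exists_test hdes
  exact conjClasses_law (levelSubmodule p m k) levelSubmodule_bi_inv htpp hf h1 h0 hε
    (by rwa [← budget_eq])

/-- **Order form for the crux**: `2^((2+ε)/3) < |GL_m(𝔽_p)|^ε` — a witness at `ε = 1/100`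
needs `|GL_m(𝔽_p)| > 2^67`. -/
theorem crux_card_law {ε : ℝ} (hε : 0 < ε) {H₁ H₂ H₃ : Subgroup (GLm p m)}
    (htpp : SubgroupTPP H₁ H₂ H₃)
    (hdes : ∃ c : Mat p m → ℂ, (∀ M, k < M.rank → c M = 0) ∧
      (∑ M, c M * ZMod.stdAddChar (Matrix.trace (M * ((1 : GLm p m) : Mat p m)))) = 1 ∧
      ∀ a ∈ H₁, ∀ b ∈ H₂, ∀ g ∈ H₃, a * b * g ≠ 1 →
        (∑ M, c M * ZMod.stdAddChar (Matrix.trace (M * ((a * b * g : GLm p m) : Mat p m)))) = 0)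
    (hlt : budget p m k (2 + ε) <
      ((Nat.card H₁ * Nat.card H₂ * Nat.card H₃ : ℕ) : ℝ) ^ ((2 + ε) / 3)) :
    (2 : ℝ) ^ ((2 + ε) / 3) < (Nat.card (GLm p m) : ℝ) ^ ε := by
  obtain ⟨f, hf, h1, h0⟩ := exists_test hdes
  exact card_law (levelSubmodule p m k) levelSubmodule_bi_inv htpp hf h1 h0 hε
    (by rwa [← budget_eq])

/-- **Walls for the crux**: `2 V² ≤ (dim F_k|_{GL_m(𝔽_p)})³`. -/
theorem crux_walls {ε : ℝ} (hε : 0 < ε) {H₁ H₂ H₃ : Subgroup (GLm p m)}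
    (htpp : SubgroupTPP H₁ H₂ H₃)
    (hdes : ∃ c : Mat p m → ℂ, (∀ M, k < M.rank → c M = 0) ∧
      (∑ M, c M * ZMod.stdAddChar (Matrix.trace (M * ((1 : GLm p m) : Mat p m)))) = 1 ∧
      ∀ a ∈ H₁, ∀ b ∈ H₂, ∀ g ∈ H₃, a * b * g ≠ 1 →
        (∑ M, c M * ZMod.stdAddChar (Matrix.trace (M * ((a * b * g : GLm p m) : Mat p m)))) = 0)
    (hlt : budget p m k (2 + ε) <
      ((Nat.card H₁ * Nat.card H₂ * Nat.card H₃ : ℕ) : ℝ) ^ ((2 + ε) / 3)) :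
    2 * (Nat.card H₁ * Nat.card H₂ * Nat.card H₃) ^ 2 ≤ (finrank ℂ (levelSubmodule p m k)) ^ 3 := by
  obtain ⟨f, hf, h1, h0⟩ := exists_test hdes
  exact two_mul_volume_sq_le_finrank_cube (levelSubmodule p m k) levelSubmodule_bi_inv htpp hf
    h1 h0 hε (by rwa [← budget_eq])

/-- **NO FIXED HOST FOR THE CRUX.**  A fixed `GL_m(𝔽_p)` carries no witness of
`SubgroupIdentityDesigns` (any level `k`) at any `ε` with `ε · log k(GL_m(𝔽_p)) ≤ (2/3) log 2`:
every witness family must let `|GL_m(𝔽_p)| → ∞` as `ε → 0`. -/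
theorem crux_no_fixed_host {ε : ℝ} (hε : 0 < ε)
    (hsmall : ε * Real.log (Nat.card (ConjClasses (GLm p m))) ≤ 2 / 3 * Real.log 2)
    {H₁ H₂ H₃ : Subgroup (GLm p m)} (htpp : SubgroupTPP H₁ H₂ H₃)
    (hdes : ∃ c : Mat p m → ℂ, (∀ M, k < M.rank → c M = 0) ∧
      (∑ M, c M * ZMod.stdAddChar (Matrix.trace (M * ((1 : GLm p m) : Mat p m)))) = 1 ∧
      ∀ a ∈ H₁, ∀ b ∈ H₂, ∀ g ∈ H₃, a * b * g ≠ 1 →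
        (∑ M, c M * ZMod.stdAddChar (Matrix.trace (M * ((a * b * g : GLm p m) : Mat p m)))) = 0) :
    ¬ budget p m k (2 + ε) <
      ((Nat.card H₁ * Nat.card H₂ * Nat.card H₃ : ℕ) : ℝ) ^ ((2 + ε) / 3) := by
  obtain ⟨f, hf, h1, h0⟩ := exists_test hdes
  rw [budget_eq]
  exact no_witness_of_small_eps (levelSubmodule p m k) levelSubmodule_bi_inv htpp hf h1 h0 hε
    hsmall

end Crux

end PackingBridge
end Summit.MatrixMultiplication.MatrixMultiplication.Theorems.SubgroupIdentityDesigns.Negative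

end
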